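import Summits.AtomisticToContinuum.HydrodynamicLimit.Theorems.InformationPercolationEngineChaosClosesEulerShellFieldC
import Summits.AtomisticToContinuum.HydrodynamicLimit.Theorems.InformationPercolationEngineChaosClosesEulerShellWin
import Summits.AtomisticToContinuum.HydrodynamicLimit.Theorems.InformationPercolationEngineChaosClosesEulerShellGlue
import Summits.AtomisticToContinuum.HydrodynamicLimit.Theorems.InformationPercolationEngineChaosClosesEulerShellData
import Literature.Analysis.FluidPDE.MVWeakStrongDefs
import HarnessLib

/-!
# BF18 shell for functions (crux `ChaosClosesEuler`, stmt-AtomisticToContinuum-15141, line `Sketch`,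
# stub `stub_bf18Shell`) — assembly core lemma `coreB`: the weighted relative-energy inequality
# (`stub_bf18ShellCoreB`)

WHAT. The second of the three core lemmas of the final assembly of the deterministic Březina–Feireisl
relative-energy shell. Setting: the equation of state `eos = EulerEOS.monatomicExcess χe f`, a classical solution
`(ρ, u, θ)` of the complete Euler system on `[0, T)`, horizons `0 < t < t' < T`, a bound `M` of the point data
and a coefficient bound `N` on `[0, t']`, the range `K` of `(ρ, θ)`, the pointwise package `hpack`
(`rawRHS + div(p̃ũ) ≤ C ℰ`, `0 ≤ ℰ`, near/far coercivity) for data with values in `K`, and a measurable bounded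
admissible shell field `V = (ϱ, m, E)` (`ϱ, E ≥ 0`, `|m|² ≤ 2ϱE`). HYPOTHESES of the shell: (H1) the continuity
law of `V` against `C¹` space–time tests on `[0, t]`; (H2) the momentum law tested with `ũ` up to a defect `δ`;
(H3) the windowed clamped entropy input for every window `[τ₀, τ₀ + Δ] ⊆ [0, t]`, defect `δ`; (H4) the energy
inequality, defect `δ`; and a function `Fm` agreeing on `[0, t]` with `F(s) = ∫ₓ ℰ(s, x)`, the space integral
of the clamped relative energy of `V` against the data, `0 ≤ Fm` on `[0, t]`. CONCLUSION (`coreB`): for every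
`τ₀ ∈ [0, t − Δ]`, with the weight `w = −cut'` of the cut-off `cut(s) = ζ((τ₀ + Δ − s)/Δ)`
(`ζ = Real.smoothTransition`), `∫_{[0,t]} w Fm ≤ Fm(0) + 3δ + C ∫_{[0,τ₀+Δ]} Fm`.

PROOF. This is the abstract weighted bookkeeping `ChaosClosesEulerShellWin.stub_bf18ShellWin` for the twelve
concrete slice functions `F = XE − XM + XC − XS + XP` (energy, `ũ·m`, `φ₁ϱ`, `θ̃ϱZ`, `p̃`; splitting
`ChaosClosesEulerShellFieldC.integral_relEnergy_split`) and sources `−GM + GC − GS + GP + GD = Rp ≤ C F`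
(`integral_rawRHS_split`, `integral_rawRHS_le` fed with `hpack` and the pointwise equations of the data
`ChaosClosesEulerShellData.pointEqs`), all integrable on `[0, t]` (`integrableOn_pieces`, `slices_relEnergy`,
`slices_rawRHS`). Its inputs: (H4) verbatim; (H2) verbatim; (H1) tested with the `C¹` extension `ψ₁` of
`½|ũ|² − μ(ρ, θ)` of a test triple (`nonempty_testTriple`, `ChaosClosesEulerShellData.cont_identity`); (H3) expanded
by the product rule in time (`ChaosClosesEulerShellGlue.windowed_entropy_le`, slice integrabilities from
`ChaosClosesEulerShellFieldB.field_entI` and `ChaosClosesEulerShellField.slice_pack`); the pressure identity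
`ChaosClosesEulerShellData.pressure_identity`; and `∫_{[0,τ]} GD = 0` (`divPU_integral_zero` for `τ > 0`, the
degenerate interval `[0, 0]` being Lebesgue-null for `τ = 0` — the registered one-liner `stub_bf18ShellCoreB`).

WHY. `coreB` is the step of the final assembly that turns the four tested balance laws of the shell field into
the single weighted inequality consumed by the windowed Grönwall lemma (`stub_bf18ShellWindow`).

No named fact is invoked.
-/

noncomputable section

namespace Summit.AtomisticToContinuum.HydrodynamicLimit.Theorems.ChaosClosesEulerShellCoreB

open Set MeasureTheory Function
open scoped InnerProductSpace BigOperators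
open Literature.MathematicalPhysics.KineticTheory (T3 V3 totalEnergyDensity)
open Literature.Analysis.FluidPDE Literature.Analysis.FluidPDE.CompressibleEuler
open Literature.Analysis.FluidPDE.CompressibleEuler.StrongPointData
open Literature.Analysis.FunctionSpaces

/-! ## The registered one-liner: the degenerate time interval -/

/-- REGISTERED SUB-GOAL `stub_bf18ShellCoreB` of the line `Sketch` (core lemma `coreB` of the BF18 shell assembly):
the degenerate interval `[0, 0] = {0}` is Lebesgue-null, so `∫_{[0,0]} G = 0` for every `G` (the case `τ = 0` of
the vanishing primitive `∫_{[0,τ]} ∫ₓ div(p̃ũ) = 0`). [folklore] -/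
theorem stub_bf18ShellCoreB : ∀ (G : ℝ → ℝ), ∫ s in Set.Icc (0 : ℝ) 0, G s = 0 := fun G => by
  rw [integral_Icc_eq_integral_Ioc, Set.Ioc_self, Measure.restrict_empty, integral_zero_measure]

/-! ## The weighted relative-energy inequality for the concrete shell field -/

/-- **Core lemma B of the BF18 shell assembly: the weighted relative-energy inequality.** For the shell field `V`
against the classical data (hypotheses (H1)–(H4) with defect `δ`, window `Δ`, package constant `C`) and `Fm = F`
on `[0, t]`, `F(s) = ∫ₓ ℰ(s, x) ≥ 0`: for every `τ₀ ∈ [0, t − Δ]`,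
`∫_{[0,t]} w Fm ≤ Fm(0) + 3δ + C ∫_{[0,τ₀+Δ]} Fm`, `w = −(d/ds) ζ((τ₀ + Δ − s)/Δ)`. [cite: BrezinaFeireisl2018, §3] -/
theorem coreB {χe f : ℝ → ℝ} {B : ℝ} (hχc : ContinuousOn χe (Set.Ioi 0)) (hfc : ContinuousOn f (Set.Ioi 0)) (hB : ∀ a, 0 < a → |χe a| ≤ B)
    {T : ℝ} {ρ θ : ℝ → T3 → ℝ} {u : ℝ → T3 → V3}
    (hcl : IsClassicalEulerSolution (EulerEOS.monatomicExcess χe f) T ρ u θ) (hG : (EulerEOS.monatomicExcess χe f).IsGibbs)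
    {t t' : ℝ} (ht0 : 0 < t) (htt' : t < t') (ht'T : t' < T)
    {M N : ℝ} (hM0 : 0 ≤ M) (hN0 : 0 ≤ N) (hM : ∀ s ∈ Set.Icc 0 t', ∀ x, (pdAt T ρ u θ (s, x)).Bounded M)
    (hN : CoeffBound (EulerEOS.monatomicExcess χe f) T ρ u θ t' N)
    {K : Set (ℝ × ℝ)} (hmemK : ∀ s ∈ Set.Icc 0 t', ∀ x, (ρ s x, θ s x) ∈ K)
    {P : ℝ} (hP1 : 1 ≤ P) (hρb : ∀ s ∈ Set.Icc 0 t', ∀ x, |ρ s x| ≤ P) (hub : ∀ s ∈ Set.Icc 0 t', ∀ x, ‖u s x‖ ≤ P)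
    (hθb : ∀ s ∈ Set.Icc 0 t', ∀ x, |θ s x| ≤ P)
    {δK a b C c : ℝ} (hδK : 0 < δK) (hab : a < b) (hC : 0 < C) (hc : 0 < c)
    (hKδ : ∀ r Θ : ℝ, (r, Θ) ∈ K → δK < r ∧ δK < Θ)
    (hpack : ∀ d : StrongPointData, (d.r, d.Θ) ∈ K → d.Bounded M → d.MassEq → d.TemperatureEq (EulerEOS.monatomicExcess χe f) →
      d.MomentumEq (EulerEOS.monatomicExcess χe f) → ∀ U : ℝ × V3 × ℝ, 0 ≤ U.1 → 0 ≤ U.2.2 → ‖U.2.1‖ ^ 2 ≤ 2 * U.1 * U.2.2 →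
      rawRHS (EulerEOS.monatomicExcess χe f) (if 0 < 2 / 3 * (U.2.2 / U.1 - ‖U.2.1‖ ^ 2 / (2 * U.1 ^ 2)) then clamp a b else fun _ => a) d U.1 (U.2.2 - ‖U.2.1‖ ^ 2 / (2 * U.1)) U.2.1 + divPU (EulerEOS.monatomicExcess χe f) d ≤
          C * d.relEnergyZ (EulerEOS.monatomicExcess χe f) (if 0 < 2 / 3 * (U.2.2 / U.1 - ‖U.2.1‖ ^ 2 / (2 * U.1 ^ 2)) then clamp a b else fun _ => a) (U.1, U.2.2 - ‖U.2.1‖ ^ 2 / (2 * U.1), U.2.1) ∧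
        0 ≤ d.relEnergyZ (EulerEOS.monatomicExcess χe f) (if 0 < 2 / 3 * (U.2.2 / U.1 - ‖U.2.1‖ ^ 2 / (2 * U.1 ^ 2)) then clamp a b else fun _ => a) (U.1, U.2.2 - ‖U.2.1‖ ^ 2 / (2 * U.1), U.2.1) ∧
        (0 < U.1 → |U.1 - d.r| ≤ δK → |stateTemp (EulerEOS.monatomicExcess χe f) U.1 (U.2.2 - ‖U.2.1‖ ^ 2 / (2 * U.1)) - d.Θ| ≤ δK →
          c * ((U.1 - d.r) ^ 2 + (stateTemp (EulerEOS.monatomicExcess χe f) U.1 (U.2.2 - ‖U.2.1‖ ^ 2 / (2 * U.1)) - d.Θ) ^ 2) +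
            (∑ i, (U.2.1 i - U.1 * d.U i) ^ 2) / (2 * U.1) ≤ d.relEnergyZ (EulerEOS.monatomicExcess χe f) (if 0 < 2 / 3 * (U.2.2 / U.1 - ‖U.2.1‖ ^ 2 / (2 * U.1 ^ 2)) then clamp a b else fun _ => a) (U.1, U.2.2 - ‖U.2.1‖ ^ 2 / (2 * U.1), U.2.1)) ∧
        (¬(0 < U.1 ∧ |U.1 - d.r| ≤ δK ∧ |stateTemp (EulerEOS.monatomicExcess χe f) U.1 (U.2.2 - ‖U.2.1‖ ^ 2 / (2 * U.1)) - d.Θ| ≤ δK) →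
          c * (1 + U.1 + U.2.2 + (∑ i, (U.2.1 i - U.1 * d.U i) ^ 2) / (2 * U.1)) ≤
            d.relEnergyZ (EulerEOS.monatomicExcess χe f) (if 0 < 2 / 3 * (U.2.2 / U.1 - ‖U.2.1‖ ^ 2 / (2 * U.1 ^ 2)) then clamp a b else fun _ => a) (U.1, U.2.2 - ‖U.2.1‖ ^ 2 / (2 * U.1), U.2.1)))
    {V : ℝ → T3 → ℝ × V3 × ℝ} (hV : Measurable (Function.uncurry V)) {CV : ℝ}
    (hCV : ∀ s x, |(V s x).1| ≤ CV ∧ ‖(V s x).2.1‖ ≤ CV ∧ |(V s x).2.2| ≤ CV)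
    (hV0 : ∀ s x, 0 ≤ (V s x).1) (hVE : ∀ s x, 0 ≤ (V s x).2.2) (hVm : ∀ s x, ‖(V s x).2.1‖ ^ 2 ≤ 2 * (V s x).1 * (V s x).2.2)
    {δ Δ : ℝ} (hΔ : 0 < Δ) (hΔt : Δ < t)
    (H1 : ∀ φ : ℝ → T3 → ℝ, ContDiff ℝ 1 (Torus.stLift φ) → ∀ τ ∈ Set.Icc 0 t,
      (∫ x, φ τ x * (V τ x).1) - ∫ x, φ 0 x * (V 0 x).1 =
        ∫ s in Set.Icc 0 τ, ∫ x, (deriv (fun s' => φ s' x) s * (V s x).1 + ∑ k : Fin 3, (V s x).2.1 k * Torus.partialDeriv k (φ s) x))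
    (H2 : ∀ τ ∈ Set.Icc 0 t, |(∫ x, ⟪u τ x, (V τ x).2.1⟫_ℝ) - (∫ x, ⟪u 0 x, (V 0 x).2.1⟫_ℝ) -
      ∫ s in Set.Icc 0 τ, ∫ x, (⟪Torus.timeDerivWithin (Set.Ico 0 T) u s x, (V s x).2.1⟫_ℝ +
        ∑ i : Fin 3, ∑ j : Fin 3, Torus.partialDeriv j (fun y => u s y i) x *
          ((V s x).2.1 i * (V s x).2.1 j / (V s x).1 + if i = j then (V s x).1 * (2 / 3 * ((V s x).2.2 / (V s x).1 - ‖(V s x).2.1‖ ^ 2 / (2 * (V s x).1 ^ 2))) * χe (V s x).1 else 0))| ≤ δ)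
    (H3 : ∀ τ₀ ∈ Set.Icc 0 (t - Δ), (∫ s in Set.Icc 0 t, ∫ x, ((V s x).1 * (if 0 < 2 / 3 * ((V s x).2.2 / (V s x).1 - ‖(V s x).2.1‖ ^ 2 / (2 * (V s x).1 ^ 2)) then max a (min (3 / 2 * Real.log (2 / 3 * ((V s x).2.2 / (V s x).1 - ‖(V s x).2.1‖ ^ 2 / (2 * (V s x).1 ^ 2))) - Real.log (V s x).1 - f (V s x).1) b) else a) *
        Torus.timeDerivWithin (Set.Ico 0 T) (fun s' y => θ s' y * Real.smoothTransition ((τ₀ + Δ - s') / Δ)) s x +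
      (if 0 < 2 / 3 * ((V s x).2.2 / (V s x).1 - ‖(V s x).2.1‖ ^ 2 / (2 * (V s x).1 ^ 2)) then max a (min (3 / 2 * Real.log (2 / 3 * ((V s x).2.2 / (V s x).1 - ‖(V s x).2.1‖ ^ 2 / (2 * (V s x).1 ^ 2))) - Real.log (V s x).1 - f (V s x).1) b) else a) * ⟪(V s x).2.1, Torus.gradient (fun y => θ s y * Real.smoothTransition ((τ₀ + Δ - s) / Δ)) x⟫_ℝ)) +
      ∫ x, (V 0 x).1 * (if 0 < 2 / 3 * ((V 0 x).2.2 / (V 0 x).1 - ‖(V 0 x).2.1‖ ^ 2 / (2 * (V 0 x).1 ^ 2)) then max a (min (3 / 2 * Real.log (2 / 3 * ((V 0 x).2.2 / (V 0 x).1 - ‖(V 0 x).2.1‖ ^ 2 / (2 * (V 0 x).1 ^ 2))) - Real.log (V 0 x).1 - f (V 0 x).1) b) else a) * (θ 0 x * Real.smoothTransition ((τ₀ + Δ - 0) / Δ)) ≤ δ)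
    (H4 : ∀ τ ∈ Set.Icc 0 t, ∫ x, (V τ x).2.2 ≤ (∫ x, (V 0 x).2.2) + δ)
    {Fm : ℝ → ℝ} (hFm : ∀ s ∈ Set.Icc 0 t, Fm s = ∫ x, (pdAt T ρ u θ (s, x)).relEnergyZ (EulerEOS.monatomicExcess χe f) (if 0 < 2 / 3 * ((V s x).2.2 / (V s x).1 - ‖(V s x).2.1‖ ^ 2 / (2 * (V s x).1 ^ 2)) then clamp a b else fun _ => a) ((V s x).1, (V s x).2.2 - ‖(V s x).2.1‖ ^ 2 / (2 * (V s x).1), (V s x).2.1)) (hF0 : ∀ s ∈ Set.Icc 0 t, 0 ≤ Fm s) :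
    ∀ τ₀ ∈ Set.Icc 0 (t - Δ), ∫ s in Set.Icc 0 t, -deriv (fun s' => Real.smoothTransition ((τ₀ + Δ - s') / Δ)) s * Fm s ≤
      Fm 0 + 3 * δ + C * ∫ s in Set.Icc 0 (τ₀ + Δ), Fm s := by
  intro τ₀ hτ₀
  -- hypotheses of the common core header that this step does not use
  have _unused : 0 ≤ M ∧ 0 ≤ N ∧ 1 ≤ P ∧ 0 < δK ∧ 0 < c ∧ Δ < t ∧ (∀ s ∈ Set.Icc 0 t', ∀ x, |ρ s x| ≤ P) ∧
      (∀ s ∈ Set.Icc 0 t', ∀ x, ‖u s x‖ ≤ P) ∧ (∀ s ∈ Set.Icc 0 t', ∀ x, |θ s x| ≤ P) ∧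
      (∀ r Θ : ℝ, (r, Θ) ∈ K → δK < r ∧ δK < Θ) :=
    ⟨hM0, hN0, hP1, hδK, hc, hΔt, hρb, hub, hθb, hKδ⟩
  have hab' : a ≤ b := hab.le
  have htT : t < T := htt'.trans ht'T
  have hτt : τ₀ + Δ ≤ t := by linarith [hτ₀.2]
  have hsub : Icc (0 : ℝ) t ⊆ Icc 0 t' := Icc_subset_Icc_right htt'.le
  have hIoo : ∀ s ∈ Ioo (0 : ℝ) t, s ∈ Icc (0 : ℝ) t' := fun s hs => ⟨hs.1.le, hs.2.le.trans htt'.le⟩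
  -- integrability on `[0, t']` of the twelve slice integrals
  obtain ⟨iXE, iXM, iXC, iXS, iXP, iGM, iGC, iGS, iGP, iGD⟩ :=
    ChaosClosesEulerShellFieldC.integrableOn_pieces hχc hfc hB hcl ht'T hV hV0 hVE hVm hCV hM hN hab'
  have iF := (ChaosClosesEulerShellFieldC.slices_relEnergy hχc hfc hcl ht'T hV hV0 hVE hVm hCV hM hN hab').2
  have iR := (ChaosClosesEulerShellFieldC.slices_rawRHS hχc hfc hB hcl ht'T hV hV0 hVE hVm hCV hM hN hab').2
  -- the two (H3) pieces: slice integrability (for the expansion of the windowed entropy input)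
  obtain ⟨-, mH, bH, mZ, bZ⟩ :=
    ChaosClosesEulerShellFieldB.field_entI hχc hfc hcl ht'T hV hV0 hVE hVm hCV hM hN hab'
  have pH := ChaosClosesEulerShellField.slice_pack _ _ _ mH bH
  have pZ := ChaosClosesEulerShellField.slice_pack _ _ _ mZ bZ
  -- (H3) expanded: `∫ cut · GS − ∫ w · XS + XS 0 ≤ δ`
  have hS := ChaosClosesEulerShellGlue.windowed_entropy_le hcl.smooth_temperature htT hΔ hτ₀.1
    (fun s x => (V s x).1)
    (fun s x => (if 0 < 2 / 3 * ((V s x).2.2 / (V s x).1 - ‖(V s x).2.1‖ ^ 2 / (2 * (V s x).1 ^ 2)) then max a (min (3 / 2 * Real.log (2 / 3 * ((V s x).2.2 / (V s x).1 - ‖(V s x).2.1‖ ^ 2 / (2 * (V s x).1 ^ 2))) - Real.log (V s x).1 - f (V s x).1) b) else a))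
    (fun s x => (V s x).2.1)
    (fun s hs => (pH.1 s (hsub hs)).1) (fun s hs => (pZ.1 s (hsub hs)).1)
    (pH.2.mono_set hsub) (pZ.2.mono_set hsub) (H3 τ₀ hτ₀)
  -- a `C¹` test triple for (H1)
  obtain ⟨Ψ⟩ := nonempty_testTriple hcl hG ht0 htT
  have eψ : ∀ s ∈ Icc (0 : ℝ) t, (fun x => energyTestFunction (EulerEOS.monatomicExcess χe f) ρ u θ s x * (V s x).1) =
      fun x => Ψ.ψ₁ s x * (V s x).1 := fun s hs =>
    funext fun x => by rw [Ψ.eq₁ s ⟨hs.1, hs.2.trans Ψ.hT.le⟩ x]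
  -- the abstract weighted bookkeeping for the twelve concrete slice functions
  exact ChaosClosesEulerShellWin.stub_bf18ShellWin t Δ τ₀ δ C Fm
    (fun s => ∫ x, (rawRHS (EulerEOS.monatomicExcess χe f) (if 0 < 2 / 3 * ((V s x).2.2 / (V s x).1 - ‖(V s x).2.1‖ ^ 2 / (2 * (V s x).1 ^ 2)) then clamp a b else fun _ => a) (pdAt T ρ u θ (s, x)) (V s x).1 ((V s x).2.2 - ‖(V s x).2.1‖ ^ 2 / (2 * (V s x).1)) (V s x).2.1 + divPU (EulerEOS.monatomicExcess χe f) (pdAt T ρ u θ (s, x))))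
    (fun s => ∫ x, (V s x).2.2)
    (fun s => ∫ x, ⟪u s x, (V s x).2.1⟫_ℝ)
    (fun s => ∫ x, energyTestFunction (EulerEOS.monatomicExcess χe f) ρ u θ s x * (V s x).1)
    (fun s => ∫ x, θ s x * ((V s x).1 *
      (if 0 < 2 / 3 * ((V s x).2.2 / (V s x).1 - ‖(V s x).2.1‖ ^ 2 / (2 * (V s x).1 ^ 2)) then max a (min (3 / 2 * Real.log (2 / 3 * ((V s x).2.2 / (V s x).1 - ‖(V s x).2.1‖ ^ 2 / (2 * (V s x).1 ^ 2))) - Real.log (V s x).1 - f (V s x).1) b) else a)))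
    (fun s => ∫ x, (EulerEOS.monatomicExcess χe f).p (ρ s x) (θ s x))
    (fun s => ∫ x, (⟪Torus.timeDerivWithin (Ico 0 T) u s x, (V s x).2.1⟫_ℝ +
        ∑ i : Fin 3, ∑ j : Fin 3, Torus.partialDeriv j (fun y => u s y i) x *
          ((V s x).2.1 i * (V s x).2.1 j / (V s x).1 + if i = j then (V s x).1 * (2 / 3 * ((V s x).2.2 / (V s x).1 - ‖(V s x).2.1‖ ^ 2 / (2 * (V s x).1 ^ 2))) * χe (V s x).1 else 0)))
    (fun s => ∫ x, (pdAt T ρ u θ (s, x)).contI (EulerEOS.monatomicExcess χe f)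
      ((V s x).1, (V s x).2.2 - ‖(V s x).2.1‖ ^ 2 / (2 * (V s x).1), (V s x).2.1))
    (fun s => ∫ x, ((V s x).1 * (if 0 < 2 / 3 * ((V s x).2.2 / (V s x).1 - ‖(V s x).2.1‖ ^ 2 / (2 * (V s x).1 ^ 2)) then max a (min (3 / 2 * Real.log (2 / 3 * ((V s x).2.2 / (V s x).1 - ‖(V s x).2.1‖ ^ 2 / (2 * (V s x).1 ^ 2))) - Real.log (V s x).1 - f (V s x).1) b) else a) *
          Torus.timeDerivWithin (Ico 0 T) θ s x +
        (if 0 < 2 / 3 * ((V s x).2.2 / (V s x).1 - ‖(V s x).2.1‖ ^ 2 / (2 * (V s x).1 ^ 2)) then max a (min (3 / 2 * Real.log (2 / 3 * ((V s x).2.2 / (V s x).1 - ‖(V s x).2.1‖ ^ 2 / (2 * (V s x).1 ^ 2))) - Real.log (V s x).1 - f (V s x).1) b) else a) *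
          ⟪(V s x).2.1, Torus.gradient (θ s) x⟫_ℝ))
    (fun s => ∫ x, (pdAt T ρ u θ (s, x)).pt (EulerEOS.monatomicExcess χe f))
    (fun s => ∫ x, divPU (EulerEOS.monatomicExcess χe f) (pdAt T ρ u θ (s, x)))
    hΔ hτ₀.1 hτt hC.le
    ((iF.mono_set hsub).congr_fun (fun s hs => (hFm s hs).symm) measurableSet_Icc)
    (iR.mono_set hsub) (iXE.mono_set hsub) (iXM.mono_set hsub) (iXC.mono_set hsub) (iXS.mono_set hsub)
    (iXP.mono_set hsub) (iGM.mono_set hsub) (iGC.mono_set hsub) (iGS.mono_set hsub) (iGP.mono_set hsub)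
    (iGD.mono_set hsub)
    (fun s hs => by
      rw [hFm s hs]
      exact ChaosClosesEulerShellFieldC.integral_relEnergy_split hχc hfc hcl ht'T hV hV0 hVE hVm hCV hM hN hab' (hsub hs))
    hF0
    (fun s hs => by
      obtain ⟨-, h1, h2⟩ := ChaosClosesEulerShellFieldC.integral_rawRHS_split hχc hfc hB hcl ht'T hV hV0 hVE hVm hCV hM hN hab'
        (hIoo s hs)
      linarith [h1, h2])
    (fun s hs => by
      have hs' : s ∈ Icc (0 : ℝ) t' := hIoo s hs
      have hsT : s ∈ Ico (0 : ℝ) T := ⟨hs.1.le, hs.2.trans htT⟩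
      rw [hFm s ⟨hs.1.le, hs.2.le⟩]
      exact ChaosClosesEulerShellFieldC.integral_rawRHS_le hχc hfc hB hcl ht'T hV hV0 hVE hVm hCV hM hN hab' hs' fun x =>
        (hpack (pdAt T ρ u θ (s, x)) (hmemK s hs' x) (hM s hs' x) (ChaosClosesEulerShellData.pointEqs hcl hG hsT x).1
          (ChaosClosesEulerShellData.pointEqs hcl hG hsT x).2.1 (ChaosClosesEulerShellData.pointEqs hcl hG hsT x).2.2 (V s x) (hV0 s x) (hVE s x)
          (hVm s x)).1)
    (fun τ hτ => by
      rcases hτ.1.eq_or_lt with h0 | hτ0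
      · subst h0
        exact stub_bf18ShellCoreB _
      · exact ChaosClosesEulerShellData.divPU_integral_zero hcl hG ht'T hM hN ⟨hτ0, hτ.2.trans_lt htt'⟩)
    H4 H2
    (fun τ hτ => by
      rw [eψ τ hτ, eψ 0 ⟨le_rfl, ht0.le⟩]
      exact ChaosClosesEulerShellData.cont_identity hcl hG Ψ le_rfl H1 hτ)
    hS
    (fun τ hτ => ChaosClosesEulerShellData.pressure_identity hcl hG ht'T hN (hsub hτ))

end Summit.AtomisticToContinuum.HydrodynamicLimit.Theorems.ChaosClosesEulerShellCoreB

end
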